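import Mathlib.MeasureTheory.Integral.CurveIntegral.Poincare
import Mathlib.Analysis.SpecialFunctions.Integrals.Basic
import Literature.Analysis.FluidPDE.CurlFreeLiouville
import Literature.Analysis.FluidPDE.BiotSavartCurlPair
import HarnessLib

/-!
# Circulation around polygons: exact fields, irrotational fields in balls, and the
antisymmetric part of the Jacobian from small parallelograms

Topic `Literature/Analysis/FluidPDE` (all results proved, no definitions). Elementary
line-integral calculus for the **discrete Kelvin argument** proving the transport of the
vorticity support of `C¹` Euler solutions (brick (B) of the decomposition of
`Literature.Analysis.FluidPDE.MajdaBertozzi2002_holderEulerUniqueness`,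
`ElgindiAprioriBlowupProofs.lean`; Majda–Bertozzi, *Vorticity and Incompressible Flow*, §1.6
Prop. 1.11 (Kelvin's circulation theorem) and Prop. 1.8, (1.51)–(1.52) (the vorticity support is
carried by the flow)). Circulations are taken around *polygons*, edge by edge, as interval
integrals `∫₀¹ ⟪v(cᵢ + θ(cᵢ₊₁ − cᵢ)), cᵢ₊₁ − cᵢ⟫ dθ`, so that neither Stokes' theorem nor the
differentiability of flow maps in the particle label is ever needed:

* `intervalIntegral_fderiv_segment`, `intervalIntegral_inner_gradient_segment`: the fundamental
  theorem of calculus along a segment (`∫₀¹ ⟪∇q, b − a⟫ = q(b) − q(a)`), and the telescoping of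
  exact increments around a closed polygon (`sum_range_eq_zero_of_eq_sub`);
* `inner_fderiv_comm_of_curl_eq_zero` / `curl_eq_zero_of_inner_fderiv_comm`: on `ℝ³`,
  `curl v(x) = 0` iff the Jacobian `Dv(x)` is symmetric;
* `sum_intervalIntegral_inner_segment_eq_zero_of_curl_eq_zero`: **an irrotational `C¹` field has
  zero circulation around every closed polygon in a ball** — the `1`-form `⟪v, ·⟫` is closed on
  the convex ball, hence exact by Mathlib's Poincaré lemma
  (`Convex.exists_forall_hasFDerivAt_of_fderiv_symmetric`), and exact increments telescope;
* `inner_fderiv_comm_of_forall_circulation_parallelogram_eq_zero`: **vanishing circulation around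
  all small parallelograms at `y₀` spanned by `a, b` forces `⟪Dv(y₀)a, b⟫ = ⟪Dv(y₀)b, a⟫** (the
  circulation of the affine part `v(y₀) + Dv(y₀)(x − y₀)` is exactly
  `η²(⟪Dv a, b⟫ − ⟪Dv b, a⟫)`, `intervalIntegral_inner_affine_segment`, and the Taylor remainder
  contributes `o(η²)`); with the previous item this recovers `curl v(y₀) = 0` from circulations —
  the converse direction, replacing Stokes' theorem on small loops.

Mathlib: curve integrals and the Poincaré lemma for `1`-forms on convex sets
(`Mathlib.MeasureTheory.Integral.CurveIntegral.Poincare`, used only through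
`Convex.exists_forall_hasFDerivAt_of_fderiv_symmetric`), `intervalIntegral.integral_eq_sub_of_hasDerivAt`,
`integral_id`, `HasFDerivAt.isLittleO`. Tree: `apply_single_comm_of_curlCLM_eq_zero`
(`CurlFreeLiouville`), `curl_eq_curlCLM`.

## References

* A. J. Majda, A. L. Bertozzi, *Vorticity and Incompressible Flow* (CUP 2002), §1.6,
  Prop. 1.11 and (1.57)–(1.61); Prop. 1.8, (1.51)–(1.52). [MajdaBertozziCUP2002]
-/

noncomputable section

open MeasureTheory Set Function Filter Topology InnerProductSpace Metric intervalIntegral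
open scoped RealInnerProductSpace

namespace Literature.Analysis.FluidPDE

/-! ### Line integrals of exact fields along segments -/

section Segment

variable {E : Type*} [NormedAddCommGroup E] [InnerProductSpace ℝ E] [CompleteSpace E]

omit [CompleteSpace E] in
/-- **Fundamental theorem of calculus along a segment**: if `f` has derivative `f' x` at every
point `x` of the segment `[a, b]` and `x ↦ f' x (b − a)` is continuous there, then
`∫₀¹ f'(a + θ(b − a)) (b − a) dθ = f b − f a`. [folklore] -/
theorem intervalIntegral_fderiv_segment {f : E → ℝ} {f' : E → E →L[ℝ] ℝ} {a b : E}
    (hf : ∀ θ ∈ Icc (0 : ℝ) 1, HasFDerivAt f (f' (a + θ • (b - a))) (a + θ • (b - a)))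
    (hcont : ContinuousOn (fun θ : ℝ => f' (a + θ • (b - a)) (b - a)) (Icc 0 1)) :
    ∫ θ in (0 : ℝ)..1, f' (a + θ • (b - a)) (b - a) = f b - f a := by
  have hσ : ∀ θ : ℝ, HasDerivAt (fun θ : ℝ => a + θ • (b - a)) (b - a) θ := fun θ => by
    simpa using ((hasDerivAt_id θ).smul_const (b - a)).const_add a
  have hderiv : ∀ θ ∈ uIcc (0 : ℝ) 1,
      HasDerivAt (fun θ : ℝ => f (a + θ • (b - a))) (f' (a + θ • (b - a)) (b - a)) θ := by
    intro θ hθ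
    rw [uIcc_of_le zero_le_one] at hθ
    exact (hf θ hθ).comp_hasDerivAt θ (hσ θ)
  have hint : IntervalIntegrable (fun θ : ℝ => f' (a + θ • (b - a)) (b - a)) volume 0 1 :=
    (hcont.mono (by rw [uIcc_of_le zero_le_one])).intervalIntegrable
  rw [integral_eq_sub_of_hasDerivAt hderiv hint]
  simp

/-- The same for the gradient of a `C¹` function: `∫₀¹ ⟪∇q(a + θ(b − a)), b − a⟫ dθ = q b − q a`. [folklore] -/
theorem intervalIntegral_inner_gradient_segment {q : E → ℝ} (hq : ContDiff ℝ 1 q) (a b : E) :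
    ∫ θ in (0 : ℝ)..1, ⟪gradient q (a + θ • (b - a)), b - a⟫ = q b - q a := by
  have e : ∀ x, ⟪gradient q x, b - a⟫ = fderiv ℝ q x (b - a) := fun x => by
    rw [gradient, InnerProductSpace.toDual_symm_apply]
  simp_rw [e]
  refine intervalIntegral_fderiv_segment (fun θ _ => (hq.differentiable one_ne_zero _).hasFDerivAt)
    ?_
  exact (((hq.continuous_fderiv one_ne_zero).comp (by fun_prop)).clm_apply
    continuous_const).continuousOn

omit [NormedAddCommGroup E] [InnerProductSpace ℝ E] [CompleteSpace E] in
/-- **A polygon sum of exact increments telescopes to zero**: if `∫_{[cᵢ, cᵢ₊₁]}` equals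
`f(cᵢ₊₁) − f(cᵢ)` for each edge of a closed polygon `c₀, …, c_N = c₀`, the total is zero. [folklore] -/
theorem sum_range_eq_zero_of_eq_sub {f : E → ℝ} {c : ℕ → E} {N : ℕ} (hcN : c N = c 0)
    {I : ℕ → ℝ} (hI : ∀ i < N, I i = f (c (i + 1)) - f (c i)) :
    ∑ i ∈ Finset.range N, I i = 0 := by
  rw [Finset.sum_congr rfl fun i hi => hI i (Finset.mem_range.1 hi)]
  have h := Finset.sum_range_sub (fun i => f (c i)) N
  rw [h, hcN, sub_self]

end Segment

/-! ### Irrotational fields on `ℝ³`: symmetric Jacobians, zero circulation around small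
polygons in balls -/

section Curl

/-- If `curl v x = 0` then the Jacobian is symmetric: `⟪Dv(x) a, b⟫ = ⟪Dv(x) b, a⟫`. [folklore] -/
theorem inner_fderiv_comm_of_curl_eq_zero {v : EuclideanSpace ℝ (Fin 3) → EuclideanSpace ℝ (Fin 3)}
    {x : EuclideanSpace ℝ (Fin 3)} (h : curl v x = 0) (a b : EuclideanSpace ℝ (Fin 3)) :
    ⟪fderiv ℝ v x a, b⟫ = ⟪fderiv ℝ v x b, a⟫ := by
  set L := fderiv ℝ v x with hL
  have hsym : ∀ i j : Fin 3, L (EuclideanSpace.single j (1 : ℝ)) i =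
      L (EuclideanSpace.single i (1 : ℝ)) j :=
    apply_single_comm_of_curlCLM_eq_zero (by rw [hL, ← curl_eq_curlCLM]; exact h)
  have ha : a = ∑ j, a j • EuclideanSpace.single j (1 : ℝ) := by
    simpa using ((EuclideanSpace.basisFun (Fin 3) ℝ).sum_repr a).symm
  have hb : b = ∑ j, b j • EuclideanSpace.single j (1 : ℝ) := by
    simpa using ((EuclideanSpace.basisFun (Fin 3) ℝ).sum_repr b).symm
  have eLa : L a = ∑ j, a j • L (EuclideanSpace.single j 1) := by
    conv_lhs => rw [ha]
    simp [map_sum, map_smul]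
  have eLb : L b = ∑ j, b j • L (EuclideanSpace.single j 1) := by
    conv_lhs => rw [hb]
    simp [map_sum, map_smul]
  rw [eLa, eLb, sum_inner, sum_inner]
  simp only [PiLp.inner_apply, RCLike.inner_apply, conj_trivial,
    Fin.sum_univ_three, PiLp.smul_apply, smul_eq_mul]
  simp only [hsym 0 1, hsym 0 2, hsym 1 2]
  ring

/-- Conversely, a symmetric Jacobian has zero curl. [folklore] -/
theorem curl_eq_zero_of_inner_fderiv_comm {v : EuclideanSpace ℝ (Fin 3) → EuclideanSpace ℝ (Fin 3)}
    {x : EuclideanSpace ℝ (Fin 3)}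
    (h : ∀ a b : EuclideanSpace ℝ (Fin 3), ⟪fderiv ℝ v x a, b⟫ = ⟪fderiv ℝ v x b, a⟫) :
    curl v x = 0 := by
  have hc : ∀ i j : Fin 3, fderiv ℝ v x (EuclideanSpace.single j (1 : ℝ)) i =
      fderiv ℝ v x (EuclideanSpace.single i (1 : ℝ)) j := by
    intro i j
    have h1 := h (EuclideanSpace.single j 1) (EuclideanSpace.single i 1)
    simpa [EuclideanSpace.inner_single_right] using h1
  ext k
  fin_cases k <;> simp [curl, hc]

/-- **Zero circulation of an irrotational field around a closed polygon in a ball** (Kelvin /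
Stokes in its most elementary form): if `v ∈ C¹(ℝ³; ℝ³)` has `curl v = 0` on the ball
`B(z₀, ρ)` and `c₀, …, c_N = c₀` are points of the ball, then
`Σᵢ ∫₀¹ ⟪v(cᵢ + θ(cᵢ₊₁ − cᵢ)), cᵢ₊₁ − cᵢ⟫ dθ = 0`: the `1`-form `⟪v, ·⟫` is closed on the convex
ball, hence exact (Mathlib's Poincaré lemma `Convex.exists_forall_hasFDerivAt_of_fderiv_symmetric`),
and the edge integrals telescope. [folklore] -/
theorem sum_intervalIntegral_inner_segment_eq_zero_of_curl_eq_zero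
    {v : EuclideanSpace ℝ (Fin 3) → EuclideanSpace ℝ (Fin 3)} (hv : ContDiff ℝ 1 v)
    {z₀ : EuclideanSpace ℝ (Fin 3)} {ρ : ℝ} (hcurl : ∀ x ∈ ball z₀ ρ, curl v x = 0)
    {c : ℕ → EuclideanSpace ℝ (Fin 3)} {N : ℕ} (hcN : c N = c 0) (hc : ∀ i ≤ N, c i ∈ ball z₀ ρ) :
    ∑ i ∈ Finset.range N,
      ∫ θ in (0 : ℝ)..1, ⟪v (c i + θ • (c (i + 1) - c i)), c (i + 1) - c i⟫ = 0 := by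
  -- the closed `1`-form `ω = ⟪v, ·⟫`
  set ω : EuclideanSpace ℝ (Fin 3) → EuclideanSpace ℝ (Fin 3) →L[ℝ] ℝ := fun x => innerSL ℝ (v x)
    with hω
  have hvd : Differentiable ℝ v := hv.differentiable one_ne_zero
  have hωd : ∀ x, HasFDerivAt ω ((innerSL ℝ : EuclideanSpace ℝ (Fin 3) →L[ℝ]
      EuclideanSpace ℝ (Fin 3) →L[ℝ] ℝ).comp (fderiv ℝ v x)) x := fun x =>
    (innerSL ℝ).hasFDerivAt.comp x (hvd x).hasFDerivAt
  have hωdiff : DifferentiableOn ℝ ω (ball z₀ ρ) := fun x _ => (hωd x).differentiableAt.differentiableWithinAt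
  have hsymm : ∀ a ∈ ball z₀ ρ, ∀ x y, fderiv ℝ ω a x y = fderiv ℝ ω a y x := by
    intro a ha x y
    rw [(hωd a).fderiv]
    simp only [ContinuousLinearMap.coe_comp, comp_apply, innerSL_apply_apply]
    exact inner_fderiv_comm_of_curl_eq_zero (hcurl a ha) x y
  obtain ⟨f, hf⟩ := (convex_ball z₀ ρ).exists_forall_hasFDerivAt_of_fderiv_symmetric isOpen_ball
    hωdiff hsymm
  -- each edge integral is an exact increment
  refine sum_range_eq_zero_of_eq_sub (f := f) hcN fun i hi => ?_
  have hseg : ∀ θ ∈ Icc (0 : ℝ) 1, c i + θ • (c (i + 1) - c i) ∈ ball z₀ ρ := by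
    intro θ hθ
    have e : c i + θ • (c (i + 1) - c i) = AffineMap.lineMap (c i) (c (i + 1)) θ := by
      rw [AffineMap.lineMap_apply_module']; abel
    rw [e]
    exact (convex_ball z₀ ρ).lineMap_mem (hc i hi.le) (hc (i + 1) hi) hθ
  have h1 := intervalIntegral_fderiv_segment (f := f) (f' := ω) (a := c i) (b := c (i + 1))
    (fun θ hθ => hf _ (hseg θ hθ)) ?_
  · rw [← h1]
    rfl
  · exact ((hv.continuous.comp (by fun_prop)).inner continuous_const).continuousOn

end Curl

/-! ### Circulation around small parallelograms detects the antisymmetric part of the Jacobian -/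

section Parallelogram

variable {E : Type*} [NormedAddCommGroup E] [InnerProductSpace ℝ E]

/-- The segment integral of an affine field: for `w(x) = w₀ + L(x − y₀)`,
`∫₀¹ ⟪w(p + θd), d⟫ dθ = ⟪w₀ + L(p − y₀), d⟫ + ½⟪Ld, d⟫`. [folklore] -/
theorem intervalIntegral_inner_affine_segment (w₀ y₀ p d : E) (L : E →L[ℝ] E) :
    ∫ θ in (0 : ℝ)..1, ⟪w₀ + L (p + θ • d - y₀), d⟫ =
      ⟪w₀ + L (p - y₀), d⟫ + 2⁻¹ * ⟪L d, d⟫ := by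
  have e : ∀ θ : ℝ, ⟪w₀ + L (p + θ • d - y₀), d⟫ = ⟪w₀ + L (p - y₀), d⟫ + θ * ⟪L d, d⟫ := by
    intro θ
    have : p + θ • d - y₀ = (p - y₀) + θ • d := by abel
    rw [this, map_add, map_smul, ← add_assoc, inner_add_left, real_inner_smul_left]
  simp_rw [e]
  have hi : IntervalIntegrable (fun θ : ℝ => θ * ⟪L d, d⟫) volume 0 1 :=
    (continuous_id.mul continuous_const).intervalIntegrable 0 1
  rw [intervalIntegral.integral_add intervalIntegrable_const hi,
    intervalIntegral.integral_const, intervalIntegral.integral_mul_const, integral_id]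
  norm_num

/-- **Vanishing circulation around all small parallelograms forces a symmetric Jacobian.** Let
`v` be continuous, differentiable at `y₀` with derivative `L`, and suppose that for all small
`η > 0` the circulation of `v` around the parallelogram with vertices
`y₀, y₀ + ηa, y₀ + ηa + ηb, y₀ + ηb` vanishes. Then `⟪La, b⟫ = ⟪Lb, a⟫`: the circulation of the
affine part `v(y₀) + L(x − y₀)` is exactly `η²(⟪La, b⟫ − ⟪Lb, a⟫)`, and the remainder is
`o(η²)`. (This replaces Stokes' theorem on the parallelogram.) [folklore] -/
theorem inner_fderiv_comm_of_forall_circulation_parallelogram_eq_zero {v : E → E} {y₀ : E}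
    {L : E →L[ℝ] E} (hvc : Continuous v) (hv : HasFDerivAt v L y₀) (a b : E)
    (h : ∀ᶠ η in 𝓝[>] (0 : ℝ),
      (∫ θ in (0 : ℝ)..1, ⟪v (y₀ + θ • (η • a)), η • a⟫) +
        (∫ θ in (0 : ℝ)..1, ⟪v (y₀ + η • a + θ • (η • b)), η • b⟫) +
        (∫ θ in (0 : ℝ)..1, ⟪v (y₀ + η • a + η • b + θ • (-(η • a))), -(η • a)⟫) +
        (∫ θ in (0 : ℝ)..1, ⟪v (y₀ + η • b + θ • (-(η • b))), -(η • b)⟫) = 0) :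
    ⟪L a, b⟫ = ⟪L b, a⟫ := by
  set A : ℝ := ⟪L a, b⟫ - ⟪L b, a⟫ with hA_def
  suffices hA0 : A = 0 by linarith
  by_contra hA
  set M : ℝ := ‖a‖ + ‖b‖ with hM
  have hM0 : 0 < M := by
    rcases (add_nonneg (norm_nonneg a) (norm_nonneg b)).lt_or_eq with hlt | heq
    · exact hlt
    · exfalso
      have ha : a = 0 := norm_eq_zero.1 (by linarith [norm_nonneg a, norm_nonneg b])
      have hb : b = 0 := norm_eq_zero.1 (by linarith [norm_nonneg a, norm_nonneg b])
      apply hA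
      simp [hA_def, ha, hb]
  set ε : ℝ := |A| / (8 * M ^ 2) with hε
  have hε0 : 0 < ε := by rw [hε]; exact div_pos (abs_pos.2 hA) (by positivity)
  -- the remainder of the first-order Taylor expansion at `y₀`
  set R : E → E := fun x => v x - v y₀ - L (x - y₀) with hR
  have hRo := hv.isLittleO.def hε0
  obtain ⟨δ, hδ0, hδ⟩ := Metric.eventually_nhds_iff.1 hRo
  have hRb : ∀ x, ‖x - y₀‖ < δ → ‖R x‖ ≤ ε * ‖x - y₀‖ := fun x hx => by
    have := hδ (by rwa [dist_eq_norm])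
    simpa [hR] using this
  -- a small `η` with vanishing circulation
  have hsmall : ∀ᶠ η in 𝓝[>] (0 : ℝ), η * M < δ := by
    have : Tendsto (fun η : ℝ => η * M) (𝓝[>] 0) (𝓝 (0 * M)) :=
      (tendsto_id.mul_const M).mono_left nhdsWithin_le_nhds
    rw [zero_mul] at this
    exact this.eventually (gt_mem_nhds hδ0)
  obtain ⟨η, ⟨hS, hηδ⟩, hη0⟩ := ((h.and hsmall).and eventually_mem_nhdsWithin).exists
  rw [mem_Ioi] at hη0
  have hηM : 0 ≤ η * M := by positivity
  -- decomposition of a segment integral into affine part and remainder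
  have hdec : ∀ p d : E, (∀ θ ∈ Icc (0 : ℝ) 1, ‖p + θ • d - y₀‖ ≤ η * M) → ‖d‖ ≤ η * M →
      |(∫ θ in (0 : ℝ)..1, ⟪v (p + θ • d), d⟫) - (⟪v y₀ + L (p - y₀), d⟫ + 2⁻¹ * ⟪L d, d⟫)| ≤
        ε * (η * M) * (η * M) := by
    intro p d hp hd
    have hc1 : Continuous fun θ : ℝ => ⟪v (p + θ • d), d⟫ :=
      (hvc.comp (continuous_const.add (continuous_id.smul continuous_const))).inner
        continuous_const
    have hc2 : Continuous fun θ : ℝ => ⟪v y₀ + L (p + θ • d - y₀), d⟫ :=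
      (continuous_const.add (L.continuous.comp ((continuous_const.add
        (continuous_id.smul continuous_const)).sub continuous_const))).inner continuous_const
    rw [← intervalIntegral_inner_affine_segment (v y₀) y₀ p d L,
      ← intervalIntegral.integral_sub (hc1.intervalIntegrable _ _) (hc2.intervalIntegrable _ _)]
    have hpt : ∀ θ ∈ Set.uIoc (0 : ℝ) 1,
        ‖⟪v (p + θ • d), d⟫ - ⟪v y₀ + L (p + θ • d - y₀), d⟫‖ ≤ ε * (η * M) * (η * M) := by
      intro θ hθ
      rw [uIoc_of_le zero_le_one] at hθ
      have hθ' : θ ∈ Icc (0 : ℝ) 1 := Ioc_subset_Icc_self hθ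
      have e : ⟪v (p + θ • d), d⟫ - ⟪v y₀ + L (p + θ • d - y₀), d⟫ = ⟪R (p + θ • d), d⟫ := by
        rw [← inner_sub_left]
        congr 1
        simp only [hR]
        abel
      rw [e, Real.norm_eq_abs]
      have hx : ‖p + θ • d - y₀‖ < δ := (hp θ hθ').trans_lt hηδ
      calc |⟪R (p + θ • d), d⟫| ≤ ‖R (p + θ • d)‖ * ‖d‖ := abs_real_inner_le_norm _ _
        _ ≤ (ε * ‖p + θ • d - y₀‖) * (η * M) :=
            mul_le_mul (hRb _ hx) hd (norm_nonneg _) (by positivity)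
        _ ≤ (ε * (η * M)) * (η * M) := by gcongr; exact hp θ hθ'
        _ = ε * (η * M) * (η * M) := by ring
    have := intervalIntegral.norm_integral_le_of_norm_le_const hpt
    rw [Real.norm_eq_abs] at this
    simpa using this
  -- the four edges
  have hna : ‖η • a‖ ≤ η * M := by
    rw [norm_smul, Real.norm_of_nonneg hη0.le]; exact mul_le_mul_of_nonneg_left (by linarith [norm_nonneg b]) hη0.le
  have hnb : ‖η • b‖ ≤ η * M := by
    rw [norm_smul, Real.norm_of_nonneg hη0.le]; exact mul_le_mul_of_nonneg_left (by linarith [norm_nonneg a]) hη0.le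
  have hθa : ∀ θ ∈ Icc (0 : ℝ) 1, ‖θ • (η • a)‖ ≤ η * ‖a‖ := fun θ hθ => by
    rw [norm_smul, norm_smul, Real.norm_of_nonneg hθ.1, Real.norm_of_nonneg hη0.le]
    calc θ * (η * ‖a‖) ≤ 1 * (η * ‖a‖) := by gcongr; exact hθ.2
      _ = η * ‖a‖ := one_mul _
  have hθb : ∀ θ ∈ Icc (0 : ℝ) 1, ‖θ • (η • b)‖ ≤ η * ‖b‖ := fun θ hθ => by
    rw [norm_smul, norm_smul, Real.norm_of_nonneg hθ.1, Real.norm_of_nonneg hη0.le]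
    calc θ * (η * ‖b‖) ≤ 1 * (η * ‖b‖) := by gcongr; exact hθ.2
      _ = η * ‖b‖ := one_mul _
  have h1θa : ∀ θ ∈ Icc (0 : ℝ) 1, ‖(1 - θ) • (η • a)‖ ≤ η * ‖a‖ := fun θ hθ => by
    rw [norm_smul, norm_smul, Real.norm_of_nonneg (by linarith [hθ.2]), Real.norm_of_nonneg hη0.le]
    calc (1 - θ) * (η * ‖a‖) ≤ 1 * (η * ‖a‖) := by gcongr; linarith [hθ.1]
      _ = η * ‖a‖ := one_mul _
  have h1θb : ∀ θ ∈ Icc (0 : ℝ) 1, ‖(1 - θ) • (η • b)‖ ≤ η * ‖b‖ := fun θ hθ => by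
    rw [norm_smul, norm_smul, Real.norm_of_nonneg (by linarith [hθ.2]), Real.norm_of_nonneg hη0.le]
    calc (1 - θ) * (η * ‖b‖) ≤ 1 * (η * ‖b‖) := by gcongr; linarith [hθ.1]
      _ = η * ‖b‖ := one_mul _
  have hηa0 : 0 ≤ η * ‖a‖ := by positivity
  have hηb0 : 0 ≤ η * ‖b‖ := by positivity
  have E0 := hdec y₀ (η • a) (fun θ hθ => by
    rw [add_sub_cancel_left]
    exact (hθa θ hθ).trans (by rw [hM]; nlinarith [norm_nonneg b])) hna
  have E1 := hdec (y₀ + η • a) (η • b) (fun θ hθ => by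
    have e : y₀ + η • a + θ • (η • b) - y₀ = η • a + θ • (η • b) := by abel
    rw [e]
    calc ‖η • a + θ • (η • b)‖ ≤ ‖η • a‖ + ‖θ • (η • b)‖ := norm_add_le _ _
      _ ≤ η * ‖a‖ + η * ‖b‖ := add_le_add (by rw [norm_smul, Real.norm_of_nonneg hη0.le]) (hθb θ hθ)
      _ = η * M := by rw [hM]; ring) hnb
  have E2 := hdec (y₀ + η • a + η • b) (-(η • a)) (fun θ hθ => by
    have e : y₀ + η • a + η • b + θ • (-(η • a)) - y₀ = (1 - θ) • (η • a) + η • b := by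
      rw [sub_smul, one_smul, smul_neg]; abel
    rw [e]
    calc ‖(1 - θ) • (η • a) + η • b‖ ≤ ‖(1 - θ) • (η • a)‖ + ‖η • b‖ := norm_add_le _ _
      _ ≤ η * ‖a‖ + η * ‖b‖ := add_le_add (h1θa θ hθ) (by rw [norm_smul, Real.norm_of_nonneg hη0.le])
      _ = η * M := by rw [hM]; ring) (by rw [norm_neg]; exact hna)
  have E3 := hdec (y₀ + η • b) (-(η • b)) (fun θ hθ => by
    have e : y₀ + η • b + θ • (-(η • b)) - y₀ = (1 - θ) • (η • b) := by
      rw [sub_smul, one_smul, smul_neg]; abel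
    rw [e]
    exact (h1θb θ hθ).trans (by rw [hM]; nlinarith [norm_nonneg a])) (by rw [norm_neg]; exact hnb)
  -- the affine contributions sum to `η² A`
  have haff : (⟪v y₀ + L (y₀ - y₀), η • a⟫ + 2⁻¹ * ⟪L (η • a), η • a⟫) +
      (⟪v y₀ + L (y₀ + η • a - y₀), η • b⟫ + 2⁻¹ * ⟪L (η • b), η • b⟫) +
      (⟪v y₀ + L (y₀ + η • a + η • b - y₀), -(η • a)⟫ + 2⁻¹ * ⟪L (-(η • a)), -(η • a)⟫) +
      (⟪v y₀ + L (y₀ + η • b - y₀), -(η • b)⟫ + 2⁻¹ * ⟪L (-(η • b)), -(η • b)⟫) = η ^ 2 * A := by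
    have e1 : y₀ + η • a - y₀ = η • a := add_sub_cancel_left _ _
    have e2 : y₀ + η • a + η • b - y₀ = η • a + η • b := by abel
    have e3 : y₀ + η • b - y₀ = η • b := add_sub_cancel_left _ _
    rw [sub_self, e1, e2, e3, hA_def]
    simp only [map_zero, add_zero, map_add, map_smul, map_neg, inner_add_left,
      inner_neg_left, inner_neg_right, real_inner_smul_left, real_inner_smul_right, neg_neg]
    ring
  -- conclusion: `|η² A| ≤ 4 ε (ηM)² = η²|A|/2`
  have key : |η ^ 2 * A| ≤ 4 * (ε * (η * M) * (η * M)) := by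
    rw [← haff]
    obtain ⟨l0, u0⟩ := abs_le.1 E0
    obtain ⟨l1, u1⟩ := abs_le.1 E1
    obtain ⟨l2, u2⟩ := abs_le.1 E2
    obtain ⟨l3, u3⟩ := abs_le.1 E3
    rw [abs_le]
    constructor <;> linarith
  have hfin : |A| ≤ |A| / 2 := by
    have hη2 : 0 < η ^ 2 := by positivity
    rw [abs_mul, abs_of_pos hη2] at key
    have e : 4 * (ε * (η * M) * (η * M)) = η ^ 2 * (|A| / 2) := by
      rw [hε]; field_simp; ring
    rw [e] at key
    exact le_of_mul_le_mul_left key hη2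
  have : |A| = 0 := by linarith [abs_nonneg A]
  exact hA (abs_eq_zero.1 this)

end Parallelogram

end Literature.Analysis.FluidPDE
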